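import Mathlib
import HarnessLib
import Summits.Ventures.LatticeQCDFlow.Exactness.LatticeIndependenceSamplerEntropyFloor
import Summits.Ventures.LatticeQCDFlow.Exactness.LatticeIndependenceSamplerAcceptanceCeiling
import Summits.Ventures.LatticeQCDFlow.Exactness.LatticeIndependenceSamplerEventTauInt

/-!
# The volume law for fixed-receptive-field exact samplers on a lattice of compact sites: `m` separated blocks of conditional variance `≥ v` and oscillation `≤ M` force `KL ≥ m·log(1 + v/(2+M)) − 2δ`, `(∫e^{−F})²/∫e^{−2F} ≤ e^{4δ}·exp(−m·e^{−4M}v/(1+M²))`, `acc ≤ e^{2δ}·exp(−m·e^{−2M}v/(4+M²))` and `τ_int(1_A) ≥ (p∧(1−p))/(p∨(1−p))·exp(m·e^{−4M}v/(1+M²) − 4δ) − ½`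

HONEST FRAMING: exact (Metropolis-corrected) sampling algorithms for lattice gauge theory;
figures of merit are autocorrelation/cost numbers at stated couplings and volumes; no
continuum-physics claim.

Venture `LatticeQCDFlow` (cell pub-lqcd), topic `Exactness`; FANOUT row 7 (`s0-cpn-null`).  NEW WORK
of the cell over this lineage's generic quartet — `Exactness/LatticeIndependenceSamplerEntropyFloor.lean`
(reverse KL), `Exactness/LatticeBlockSecondMomentTensorization.lean` (second moment of the weights),
`Exactness/LatticeIndependenceSamplerAcceptanceCeiling.lean` (acceptance) and
`Exactness/LatticeIndependenceSamplerEventTauInt.lean` (`τ_int` of events); nothing is cited as a fact.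
Printed counterparts, NAMED ONLY: Abbott et al., Phys. Rev. D 106 (2022) 074506, §V item 4 ("for
fixed models the sampling cost grows exponentially with the volume"); the venture's finite-state
barrier B1 `Scaling/Barriers.VolumeScalingOfTraining` (theory-2).  THE QUOTABLE FORM.  Sites `ι`
(finite), compact metric site space `X` with a Borel probability measure `μ`, `π = ⊗_ι μ`; a continuous
log-weight `F` on `X^ι` within `δ` of `Σ_{j∈T} h_j + r` where the `h_j` are continuous, depend on
pairwise disjoint sets `D_j ⊇ B_j`, have oscillation `≤ M` and corridor-conditional variance
`Var_π(A_C h_j) ≥ v` (`C = ι ∖ ⋃_j B_j`), and `r` is continuous depending on the complement of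
`⋃_j B_j`; `m = #T`.  Then, for the independence Metropolis sampler with target `π.tilted(−F)` and
proposal `π` (row 2's `imhOp π e^{−F} 1`):
`KL(π ‖ π.tilted(−F)) = ∫F dπ + log∫e^{−F}dπ ≥ m·log(1 + v/(2 + M)) − 2δ` (training objective linear in
the volume), `(∫e^{−F}dπ)²·exp(m·e^{−4M}v/(1 + M²)) ≤ e^{4δ}·∫e^{−2F}dπ` (effective sample size exponentially
small), `acc·exp(m·e^{−2M}v/(4 + M²)) ≤ e^{2δ}` (acceptance exponentially small), and for every event `A`
of target probability `p ∈ (0,1)`: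
`τ_int(1_A) ≥ (p∧(1−p))/(p∨(1−p))·exp(m·e^{−4M}v/(1 + M²) − 4δ) − ½` (autocorrelation time of every
sector indicator exponentially large) — THE VOLUME LAW FOR FIXED-RECEPTIVE-FIELD EXACT SAMPLERS ON
CONTINUOUS COMPACT CONFIGURATION SPACES, the block defect being the explicit pair `(v, M)`.

## Content

* **`latticeIndep_volumeLaw_kl`**, **`latticeIndep_volumeLaw_ess`**, **`latticeIndep_volumeLaw_meanAccept`**,
  **`latticeIndep_volumeLaw_event_tauInt`** — the four displayed inequalities.

NOT CLAIMED: how to exhibit `(v, M)` for a given model and flow (the lattice-of-spheres / exact-LO-flow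
files do it for the CP(N−1)/O(N) link model: `SphereLOCarrePairConditionalVariance`, `Torus*`);
non-compact sites; numbers.
-/

noncomputable section

namespace Summit.Ventures.LatticeQCDFlow.Exactness

open Function Set Metric MeasureTheory
open Summit.Ventures.LatticeQCDFlow.Scoring
open scoped Topology

variable {ι : Type*} [Fintype ι] [DecidableEq ι]
variable {X : Type*} [MeasurableSpace X] [MetricSpace X] [CompactSpace X] [BorelSpace X]
  (μ : Measure X) [IsProbabilityMeasure μ]

section VolumeLaw

variable {J : Type*} (T : Finset J) (B D : J → Finset ι)
  (hBD : ∀ j ∈ T, B j ⊆ D j) (hD : ∀ j ∈ T, ∀ j' ∈ T, j ≠ j' → Disjoint (D j) (D j'))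
  {h : J → (ι → X) → ℝ} (hc : ∀ j ∈ T, Continuous (h j)) (hdep : ∀ j ∈ T, DependsOn (h j) ↑(D j))
  {M : ℝ} (hM0 : 0 ≤ M) (hM : ∀ j ∈ T, ∀ ω ω', |h j ω - h j ω'| ≤ M)
  {r : (ι → X) → ℝ} (hr : Continuous r) (hrdep : DependsOn r (↑(T.biUnion B) : Set ι)ᶜ)
  {F : (ι → X) → ℝ} (hF : Continuous F) {δ : ℝ} (hδ : ∀ ω, |F ω - (∑ j ∈ T, h j ω + r ω)| ≤ δ)
  {v : ℝ} (hv0 : 0 ≤ v) (hv : ∀ j ∈ T, v ≤ ∫ ω, (coordAvg μ (Finset.univ \ T.biUnion B) (h j) ω -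
      ∫ ω', h j ω' ∂Measure.pi (fun _ : ι => μ)) ^ 2 ∂Measure.pi (fun _ : ι => μ))

include hBD hD hc hdep hM0 hM hr hrdep hF hδ hv

include hv0 in
/-- **VOLUME LAW, REVERSE RELATIVE ENTROPY** (`v ≥ 0`): `m·log(1 + v/(2 + M)) − 2δ ≤ ∫F dπ + log∫e^{−F}dπ`. -/
theorem latticeIndep_volumeLaw_kl :
    T.card * Real.log (1 + v / (2 + M)) - 2 * δ ≤
      (∫ ω, F ω ∂Measure.pi (fun _ : ι => μ)) +
        Real.log (∫ ω, Real.exp (-F ω) ∂Measure.pi (fun _ : ι => μ)) := by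
  have hmain := latticeIndep_sum_log_one_add_variance_sub_le μ T B D hBD hD hc hdep
    (M := fun _ => M) (fun j _ => hM0) hM hr hrdep hF hδ
  refine le_trans (sub_le_sub_right ?_ _) hmain
  rw [← nsmul_eq_mul]
  apply Finset.card_nsmul_le_sum
  intro j hj
  have h2 : 0 < 2 + M := by linarith
  have hle := div_le_div_of_nonneg_right (hv j hj) h2.le
  have hpos : 0 < 1 + v / (2 + M) := by positivity
  exact Real.log_le_log hpos (by linarith)

/-- **VOLUME LAW, EFFECTIVE SAMPLE SIZE**: `(∫e^{−F}dπ)²·exp(m·e^{−4M}v/(1 + M²)) ≤ e^{4δ}·∫e^{−2F}dπ`. -/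
theorem latticeIndep_volumeLaw_ess :
    (∫ ω, Real.exp (-F ω) ∂Measure.pi (fun _ : ι => μ)) ^ 2 *
        Real.exp (T.card * (Real.exp (-4 * M) * v / (1 + M ^ 2))) ≤
      Real.exp (4 * δ) * ∫ ω, Real.exp (-2 * F ω) ∂Measure.pi (fun _ : ι => μ) := by
  have hmain := sq_integral_exp_neg_mul_exp_le_of_abs_sub_le μ T B D hBD hD hc hdep
    (M := fun _ => M) (fun j _ => hM0) hM hr hrdep hF hδ
  refine le_trans (mul_le_mul_of_nonneg_left (Real.exp_le_exp.2 ?_) (sq_nonneg _)) hmain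
  rw [← nsmul_eq_mul]
  apply Finset.card_nsmul_le_sum
  intro j hj
  exact div_le_div_of_nonneg_right (mul_le_mul_of_nonneg_left (hv j hj) (Real.exp_pos _).le)
    (by positivity)

/-- **VOLUME LAW, ACCEPTANCE**: `acc·exp(m·e^{−2M}v/(4 + M²)) ≤ e^{2δ}`. -/
theorem latticeIndep_volumeLaw_meanAccept :
    (∫ ω, (∫ ω', min 1 (Real.exp (F ω - F ω')) ∂Measure.pi (fun _ : ι => μ))
      ∂(Measure.pi (fun _ : ι => μ)).tilted (fun ω => -F ω)) *
        Real.exp (T.card * (Real.exp (-2 * M) * v / (4 + M ^ 2))) ≤ Real.exp (2 * δ) := by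
  have hmain := latticeIndep_meanAccept_mul_exp_blockSum_le μ T B D hBD hD hc hdep
    (M := fun _ => M) (fun j _ => hM0) hM hr hrdep hF hδ
  have hacc0 : 0 ≤ ∫ ω, (∫ ω', min 1 (Real.exp (F ω - F ω')) ∂Measure.pi (fun _ : ι => μ))
      ∂(Measure.pi (fun _ : ι => μ)).tilted (fun ω => -F ω) :=
    integral_nonneg fun ω => integral_nonneg fun ω' => le_min zero_le_one (Real.exp_pos _).le
  refine le_trans (mul_le_mul_of_nonneg_left (Real.exp_le_exp.2 ?_) hacc0) hmain
  rw [← nsmul_eq_mul]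
  apply Finset.card_nsmul_le_sum
  intro j hj
  exact div_le_div_of_nonneg_right (mul_le_mul_of_nonneg_left (hv j hj) (Real.exp_pos _).le)
    (by positivity)

/-- **VOLUME LAW, AUTOCORRELATION OF EVENTS**: for every measurable event `A` of target probability
`p` (`p·∫e^{−F}dπ = ∫_A e^{−F}dπ`, `0 < p < 1`),
`(p∧(1−p))/(p∨(1−p))·exp(m·e^{−4M}v/(1 + M²) − 4δ) − ½ ≤ τ_int(1_A)`. -/
theorem latticeIndep_volumeLaw_event_tauInt {A : Set (ι → X)} (hA : MeasurableSet A) {p : ℝ}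
    (hp0 : 0 < p) (hp1 : p < 1)
    (hpA : p * ∫ ω, Real.exp (-F ω) ∂Measure.pi (fun _ : ι => μ) =
      ∫ ω in A, Real.exp (-F ω) ∂Measure.pi (fun _ : ι => μ)) :
    min p (1 - p) / max p (1 - p) *
        Real.exp (T.card * (Real.exp (-4 * M) * v / (1 + M ^ 2)) - 4 * δ) - 1 / 2 ≤
      tauInt (fun k => (∫ ω, (A.indicator (fun _ => (1 : ℝ)) ω - p) *
        ((imhOp (Measure.pi (fun _ : ι => μ)) (fun η => Real.exp (-F η)) (fun _ => (1 : ℝ)))^[k]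
          (fun ω => A.indicator (fun _ => (1 : ℝ)) ω - p)) ω * Real.exp (-F ω)
          ∂Measure.pi (fun _ : ι => μ)) /
        ∫ ω, (A.indicator (fun _ => (1 : ℝ)) ω - p) ^ 2 * Real.exp (-F ω) ∂Measure.pi (fun _ : ι => μ)) := by
  have hZpos : 0 < ∫ ω, Real.exp (-F ω) ∂Measure.pi (fun _ : ι => μ) :=
    integral_exp_pos (integrable_pi_of_continuous μ (Real.continuous_exp.comp hF.neg))
  have hA0 : 0 < ∫ ω in A, Real.exp (-F ω) ∂Measure.pi (fun _ : ι => μ) := by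
    rw [← hpA]; positivity
  have hA1 : ∫ ω in A, Real.exp (-F ω) ∂Measure.pi (fun _ : ι => μ) <
      ∫ ω, Real.exp (-F ω) ∂Measure.pi (fun _ : ι => μ) := by
    rw [← hpA]; nlinarith
  have hmain := latticeIndep_event_tauInt_ge_exp_blockSum μ T B D hBD hD hc hdep
    (M := fun _ => M) (fun j _ => hM0) hM hr hrdep hF hδ hA hA0 hA1
  have hpq : (∫ ω in A, Real.exp (-F ω) ∂Measure.pi (fun _ : ι => μ)) /
      (∫ ω, Real.exp (-F ω) ∂Measure.pi (fun _ : ι => μ)) = p := by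
    rw [← hpA, mul_div_assoc, div_self hZpos.ne', mul_one]
  rw [hpq] at hmain
  refine le_trans (sub_le_sub_right ?_ _) hmain
  have hcoef : 0 ≤ min p (1 - p) / max p (1 - p) :=
    div_nonneg (le_min hp0.le (by linarith)) (le_max_of_le_left hp0.le)
  refine mul_le_mul_of_nonneg_left ?_ hcoef
  rw [Real.exp_sub, div_eq_mul_inv, ← Real.exp_neg, mul_comm]
  refine mul_le_mul_of_nonneg_left (Real.exp_le_exp.2 ?_) (Real.exp_pos _).le
  rw [← nsmul_eq_mul]
  apply Finset.card_nsmul_le_sum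
  intro j hj
  exact div_le_div_of_nonneg_right (mul_le_mul_of_nonneg_left (hv j hj) (Real.exp_pos _).le)
    (by positivity)

end VolumeLaw

end Summit.Ventures.LatticeQCDFlow.Exactness

end
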